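import Summits.NavierStokesRegularity.NavierStokesRegularity.Theorems.ClockStretchingLawClockCeilingIffTarget
import Summits.NavierStokesRegularity.NavierStokesRegularity.Theorems.SqueezeCycleExtremalBiaxialitySubcriticalIffTypeIAncientLiouville
import HarnessLib

/-!
# Route `ClockStretchingLaw`, crux `ClockCeiling` (stmt-NavierStokesRegularity-10570) lies on the
# Type-I Liouville node: `ClockCeiling ↔ TypeIAncientLiouville` (stmt-4050) and its six other spellings

Line `registered` of the crux, lead c2 (2026-08-17), `--supports` certificate. By
`clockCeiling_iff_noSingularTypeIModel` (file `ClockStretchingLawClockCeilingIffTarget.lean`: the crux is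
its own route's target, given the proved `ClockLaw`) and the landed node equivalences of
`SqueezeCycleExtremalBiaxialitySubcriticalIffTypeIAncientLiouville.lean` /
`…IffRecurrentLiouville.lean` (items 10569, 11608, 11609, 4050, 1589, 1588, 11716 ∧ 11719 are pairwise
equivalent by kernel-checked theorems), the crux `ClockCeiling` is, BY NAME, equivalent to each of:

* `SymmetryModuliCount.TypeIAncientLiouville` (stmt-4050; = `ExtremalTypeIConstant.TypeIAncientLiouville`):
  Type-I Liouville in the KNSS gauge — every smooth divergence-free KNSS-mild ancient field with
  `‖u‖ ≤ C/√(−t)` vanishes (`stub_clockCeilingIffTypeIAncientLiouville`);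
* `SqueezeCycle.SqueezeLiouville` (stmt-11608), `SqueezeCycle.ExtremalBiaxialitySubcritical` (stmt-11609);
* `SqueezeCycle.RecurrentLiouville` = `RecurrentProfiles.RecurrentLiouville` (stmt-1589);
* `RecurrentProfiles.NoTypeIRateProfile` = `DulacContraction.NoTypeIRateProfile` (stmt-1588);
* `RellichScar.NoApexTypeIProfile ∧ RellichScar.ApexLocalisation` (stmt-11716 ∧ stmt-11719);

and its negation is the existence of a Type-I singularity model of the Albritton–Barker class
(`clockCeiling_false_iff_typeISingularProfileExists`, kill criterion of crux 1589). It follows from the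
KNSS Liouville conjecture (L) (`clockCeiling_of_liouvilleConjectureNS`, CONDITIONAL). So the residual
stub `stub_frameCeiling` of the line, the crux, the route target and the Liouville node are one open
statement (Bradshaw–Tsai 2017 Open Problem 5.1 / Tsai's conjecture sits inside its negation).

## References

* G. Koch, N. Nadirashvili, G. Seregin, V. Šverák, Acta Math. 203 (2009) = arXiv:0709.3599, §1, §6.
  [KochNadirashviliSereginSverak2009]
* D. Albritton, T. Barker, J. Math. Fluid Mech. 21 (2019) = arXiv:1811.00502, Thm. 1.1, §3.
  [AlbrittonBarker2019]
* Z. Bradshaw, T.-P. Tsai, CPDE 42 (2017), Open Problem 5.1. [BradshawTsai2017CPDE]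
-/

noncomputable section

-- `Summit = Problem` namespace duplication is the tree's layout (CONVENTIONS §1); as in every Theorems file.
set_option linter.dupNamespace false

namespace Summit.NavierStokesRegularity.NavierStokesRegularity.Theorems

open Summit.NavierStokesRegularity.NavierStokesRegularity.Theses

/-- **CERTIFICATE `stub_clockCeilingIffTypeIAncientLiouville`: the crux `ClockCeiling` (stmt-10570) is
the Type-I Liouville statement `TypeIAncientLiouville` (stmt-4050), by name.**
[cite: KochNadirashviliSereginSverak2009, §1 and §6] [cite: AlbrittonBarker2019, Thm 1.1, §3] -/
theorem stub_clockCeilingIffTypeIAncientLiouville :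
    Summit.NavierStokesRegularity.NavierStokesRegularity.Theses.ClockStretchingLaw.ClockCeiling ↔
      Summit.NavierStokesRegularity.NavierStokesRegularity.Theses.SymmetryModuliCount.TypeIAncientLiouville :=
  clockCeiling_iff_noSingularTypeIModel.trans
    (squeezeLiouville_iff_noSingularTypeIModel.symm.trans squeezeLiouville_iff_typeIAncientLiouville)

/-- `ClockCeiling ↔ TypeIAncientLiouville` (items 10570 ↔ 4050; short name of the certificate).
[cite: KochNadirashviliSereginSverak2009, §1 and §6] -/
theorem clockCeiling_iff_typeIAncientLiouville :
    ClockStretchingLaw.ClockCeiling ↔ SymmetryModuliCount.TypeIAncientLiouville :=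
  stub_clockCeilingIffTypeIAncientLiouville

/-- `ClockCeiling ↔ ExtremalTypeIConstant.TypeIAncientLiouville` (route ExtremalTypeIConstant's copy of
item 4050, letter for letter the SymmetryModuliCount one). [cite: KochNadirashviliSereginSverak2009, §1 and §6] -/
theorem clockCeiling_iff_extremalTypeIConstant_typeIAncientLiouville :
    ClockStretchingLaw.ClockCeiling ↔ ExtremalTypeIConstant.TypeIAncientLiouville :=
  clockCeiling_iff_typeIAncientLiouville.trans Iff.rfl

/-- `ClockCeiling ↔ SqueezeLiouville` (items 10570 ↔ 11608). [cite: AlbrittonBarker2019, Thm 1.1, §3] -/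
theorem clockCeiling_iff_squeezeLiouville :
    ClockStretchingLaw.ClockCeiling ↔ SqueezeCycle.SqueezeLiouville :=
  clockCeiling_iff_noSingularTypeIModel.trans squeezeLiouville_iff_noSingularTypeIModel.symm

/-- `ClockCeiling ↔ ExtremalBiaxialitySubcritical` (items 10570 ↔ 11609). [cite: AlbrittonBarker2019, Thm 1.1, §3] -/
theorem clockCeiling_iff_extremalBiaxialitySubcritical :
    ClockStretchingLaw.ClockCeiling ↔ SqueezeCycle.ExtremalBiaxialitySubcritical :=
  clockCeiling_iff_noSingularTypeIModel.trans extremalBiaxialitySubcritical_iff_noSingularTypeIModel.symm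

/-- `ClockCeiling ↔ RecurrentLiouville` (items 10570 ↔ 1589, SqueezeCycle spelling).
[cite: AlbrittonBarker2019, Thm 1.1, §3] -/
theorem clockCeiling_iff_recurrentLiouville :
    ClockStretchingLaw.ClockCeiling ↔ SqueezeCycle.RecurrentLiouville :=
  clockCeiling_iff_typeIAncientLiouville.trans typeIAncientLiouville_iff_recurrentLiouville

/-- `ClockCeiling ↔ RecurrentProfiles.RecurrentLiouville` (items 10570 ↔ 1589, RecurrentProfiles spelling,
letter for letter the SqueezeCycle one). [cite: AlbrittonBarker2019, Thm 1.1, §3] -/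
theorem clockCeiling_iff_recurrentProfiles_recurrentLiouville :
    ClockStretchingLaw.ClockCeiling ↔ RecurrentProfiles.RecurrentLiouville :=
  clockCeiling_iff_recurrentLiouville.trans Iff.rfl

/-- `ClockCeiling ↔ NoTypeIRateProfile` (items 10570 ↔ 1588): the clock ceiling on `𝒦_C` and "no
Type-I-rate singular profile in the Albritton–Barker local-energy class" are the same statement.
[cite: AlbrittonBarker2019, Thm 1.1, §3] -/
theorem clockCeiling_iff_noTypeIRateProfile :
    ClockStretchingLaw.ClockCeiling ↔ RecurrentProfiles.NoTypeIRateProfile :=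
  clockCeiling_iff_typeIAncientLiouville.trans typeIAncientLiouville_iff_noTypeIRateProfile

/-- `ClockCeiling ↔ DulacContraction.NoTypeIRateProfile` (route DulacContraction's copy of item 1588).
[cite: AlbrittonBarker2019, Thm 1.1, §3] -/
theorem clockCeiling_iff_dulacContraction_noTypeIRateProfile :
    ClockStretchingLaw.ClockCeiling ↔ DulacContraction.NoTypeIRateProfile :=
  clockCeiling_iff_noTypeIRateProfile.trans Iff.rfl

/-- `ClockCeiling ↔ (NoApexTypeIProfile ∧ ApexLocalisation)` (items 10570 ↔ 11716 ∧ 11719).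
[cite: AlbrittonBarker2019, Thm 1.1, §3] [cite: KNSS2009, (1.6)] -/
theorem clockCeiling_iff_rellichScar :
    ClockStretchingLaw.ClockCeiling ↔
      (RellichScar.NoApexTypeIProfile ∧ RellichScar.ApexLocalisation) :=
  clockCeiling_iff_typeIAncientLiouville.trans typeIAncientLiouville_iff_rellichScar

/-- **KILL CRITERION of the crux.** `ClockCeiling` is false iff some suitable weak solution on the backward
slab with weak gradient, `𝐈 < ⊤` and the Type-I rate is backward-singular at the origin (a Type-I
singularity model of the Albritton–Barker class, e.g. the profile of a backward `λ`-DSS / RDSS Type-I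
blow-up — Bradshaw–Tsai Open Problem 5.1; none is known). [cite: AlbrittonBarker2019, Thm. 1.1, Prop. 2.3] -/
theorem clockCeiling_false_iff_typeISingularProfileExists :
    ¬ ClockStretchingLaw.ClockCeiling ↔ RecurrentLiouville.Negative.TypeISingularProfileExists :=
  (not_congr clockCeiling_iff_recurrentLiouville).trans
    RecurrentLiouville.Negative.recurrentLiouville_false_iff_typeISingularProfileExists

/-- **`ClockCeiling` holds under the KNSS Liouville conjecture (L)** (`LiouvilleConjectureNS`, the
summit's conjecture leaf): (L) gives `SqueezeLiouville` (`squeezeLiouville_of_liouvilleConjectureNS`),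
hence the crux. CONDITIONAL on the open conjecture; it does not close the item.
[cite: KochNadirashviliSereginSverak2009, §1 conjecture (L) (arXiv:0709.3599)] -/
theorem clockCeiling_of_liouvilleConjectureNS
    (hL : Summit.NavierStokesRegularity.NavierStokesRegularity.LiouvilleConjectureNS) :
    ClockStretchingLaw.ClockCeiling :=
  clockCeiling_iff_squeezeLiouville.2 (squeezeLiouville_of_liouvilleConjectureNS hL)

/-- **The line's residual stub is the Liouville node**: the four-frame ceiling `stub_frameCeiling` of line
`registered` ↔ `TypeIAncientLiouville` (stmt-4050). [cite: KochNadirashviliSereginSverak2009, §1 and §6] -/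
theorem frameCeiling_iff_typeIAncientLiouville :
    (∀ (C : ℝ) (u : ℝ → EuclideanSpace ℝ (Fin 3) → EuclideanSpace ℝ (Fin 3)), ContDiffOn ℝ (⊤ : ℕ∞) (Function.uncurry u) (Set.Iio 0 ×ˢ Set.univ) ∧ (∀ t < 0, Literature.Analysis.FluidPDE.VectorCalculus.IsDivFree (u t)) ∧ (∀ s t : ℝ, s < t → t < 0 → ∀ x, u t x = Literature.Analysis.FluidPDE.heatFlow (u s) (t - s) x - ∫ τ in Set.Ioo s t, ∫ y, ((-(inner ℝ (x - y) (u τ y) / (2 * (t - τ)) * Literature.Analysis.UnboundedOperators.heatKernel (t - τ) (x - y))) • u τ y + (∫ σ in Set.Ioi (t - τ), Literature.Analysis.UnboundedOperators.heatKernel σ (x - y) / (4 * σ ^ 2)) • (inner ℝ (x - y) (u τ y) • u τ y + inner ℝ (u τ y) (u τ y) • (x - y) + inner ℝ (x - y) (u τ y) • u τ y) - ((∫ σ in Set.Ioi (t - τ), Literature.Analysis.UnboundedOperators.heatKernel σ (x - y) / (8 * σ ^ 3)) * (inner ℝ (x - y) (u τ y) * inner ℝ (x - y) (u τ y))) • (x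 - y))) ∧ Literature.Analysis.FluidPDE.HasTypeITimeDecay C u ∧ (∀ (x₀ : EuclideanSpace ℝ (Fin 3)) (t₀ r : ℝ), t₀ ≤ 0 → 0 < r → (∀ t, t₀ - r ^ 2 < t → t < t₀ → r⁻¹ * ∫ x in Metric.ball x₀ r, ‖u t x‖ ^ 2 ≤ C) ∧ r⁻¹ * ∫ t in Set.Ioo (t₀ - r ^ 2) t₀, ∫ x in Metric.ball x₀ r, ‖fderiv ℝ (u t) x‖ ^ 2 ≤ C) → ∀ η > 0, ∃ t : ℝ, -1 ≤ t ∧ t < 0 ∧ ∃ (c₀ : ℝ) (b : EuclideanSpace ℝ (Fin 3)), c₀ ^ 2 + ‖b‖ ^ 2 = 1 ∧ Real.sqrt (-t) * ∫ x, ‖(c₀ * Real.sqrt (-t)) • Literature.Analysis.FluidPDE.timeDeriv u t x + fderiv ℝ (u t) x b‖ ^ 2 * Real.exp (-(‖x‖ ^ 2) / (4 * (-t))) < η) ↔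
      SymmetryModuliCount.TypeIAncientLiouville :=
  frameCeiling_iff_clockCeiling.trans clockCeiling_iff_typeIAncientLiouville

end Summit.NavierStokesRegularity.NavierStokesRegularity.Theorems

end
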